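import Mathlib.LinearAlgebra.Basis.VectorSpace
import Mathlib.LinearAlgebra.Dimension.Finite
import Mathlib.Data.Int.LeastGreatest
import HarnessLib

/-!
# Bases adapted to a finite decreasing `ℤ`-filtration of a finite-dimensional vector space

Topic `Algebra/Module`; namespace `Literature.Algebra.Module`. THEOREMS ONLY (Mathlib-only imports; no
definition, no named fact, no instance, no `sorry`).

Let `V` be a finite-dimensional vector space over a division ring `K` and `N : ℤ → Submodule K V` a
DECREASING filtration (`Antitone N`) which is exhaustive and separated at finite stages: `N a = ⊤` and
`N b = ⊥` for some `a b : ℤ`. Then `V` has a basis ADAPTED to `N`: a basis `e : Fin n → V` with integer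
WEIGHTS `w : Fin n → ℤ` such that, for every `m : ℤ`,

  `v ∈ N m ↔` every nonzero coordinate of `v` sits on a basis vector of weight `≥ m`

(`exists_basis_mem_iff_of_antitone`), i.e. `N m = span {e k | m ≤ w k}`; in particular `e k ∈ N (w k)`,
`e k ∉ N (w k + 1)` and `a ≤ w k < b`. Equivalently the images of the `e k` with `w k = m` form a basis of
`gr^m = N m / N (m+1)`. Construction (the printed one): a basis of `N (b-1)`, extended to a basis of
`N (b-2)`, …, extended to a basis of `N a = V` (Mathlib `LinearIndepOn.extend`); the weight of a vector is
the stage at which it was added (`exists_linearIndepOn_span_inter_eq`: the intermediate sets `T_j ⊆ N (b-j)`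
are linearly independent with `span (T_j ∩ N m) = N m` for all `m ≥ b - j`).

Use (tree): the Hodge filtration `Fil^i D_dR(V) = D_dR(V) ∩ (Fil^i B_dR ⊗ V)` of a de Rham representation
(`Literature.NumberTheory.GaloisRepresentations.PeriodRingData.filD`), whose adapted bases carry Fontaine's
filtered comparison isomorphism `Fil^n (B_dR ⊗ V) = ⊕_k Fil^{n - w k} B_dR · e_k`.

## Source

* N. Wach, *Représentations p-adiques potentiellement cristallines*, Bull. Soc. Math. France **124**
  (1996), §B.2.3, proof of Prop. 2 (p. 394; held `paper:doi-10-24033-bsmf-2285`): « Soit `(u_1, …, u_d)` une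
  base de `D` adaptée à la filtration, c'est-à-dire telle que, si on note `r_i` le plus grand entier tel que
  `u_i ∈ Fil^{r_i} D`, alors `Fil^n D = ⊕_{r_i ≥ n} K u_i` » — the existence of such a basis for a
  finite-dimensional `K`-vector space with a decreasing (exhaustive, separated) filtration is what this file
  proves, in the coordinate form `v ∈ N m ↔ (e.repr v k ≠ 0 → m ≤ w k)` (`w k = r_k`). [Wach1996]
* Standard linear algebra (extension of bases: Bourbaki, *Algèbre* II §7). [folklore]
-/

namespace Literature.Algebra.Module

open Submodule Set

variable {K V : Type*} [DivisionRing K] [AddCommGroup V] [Module K V]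

/-- **Successive extension of bases along a decreasing filtration.** For an antitone
`N : ℤ → Submodule K V` with `N b = ⊥` and every `j : ℕ` there is a linearly independent set
`T ⊆ N (b - j)` such that `span (T ∩ N m) = N m` for every `m ≥ b - j` (a basis of `N (b-1)` extended
to a basis of `N (b-2)`, …, extended to a basis of `N (b-j)`); the construction behind Wach's « base adaptée à
la filtration ». [cite: Wach1996, §B.2.3, proof of Prop. 2 (p. 394)] -/
theorem exists_linearIndepOn_span_inter_eq (N : ℤ → Submodule K V) (hN : Antitone N) {b : ℤ}
    (hb : N b = ⊥) (j : ℕ) :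
    ∃ T : Set V, LinearIndepOn K id T ∧ T ⊆ (N (b - j) : Set V) ∧
      ∀ m : ℤ, b - j ≤ m → span K (T ∩ (N m : Set V)) = N m := by
  induction j with
  | zero =>
    refine ⟨∅, linearIndepOn_empty K id, Set.empty_subset _, fun m hm => ?_⟩
    rw [Set.empty_inter, span_empty]
    simp only [Nat.cast_zero, sub_zero] at hm
    exact (eq_bot_iff.2 ((hN hm).trans hb.le)).symm
  | succ j ih =>
    obtain ⟨T, hTli, hTsub, hTspan⟩ := ih
    have hcast : (b - ((j + 1 : ℕ) : ℤ)) = b - j - 1 := by push_cast; ring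
    have hle : N (b - j) ≤ N (b - ((j + 1 : ℕ) : ℤ)) := hN (by rw [hcast]; linarith)
    have hst : T ⊆ (N (b - ((j + 1 : ℕ) : ℤ)) : Set V) := hTsub.trans hle
    refine ⟨hTli.extend hst, hTli.linearIndepOn_extend hst, hTli.extend_subset hst, fun m hm => ?_⟩
    rcases eq_or_lt_of_le hm with hm' | hm'
    · -- the new bottom stage: `T' ∩ N m = T'` spans `N m`
      rw [← hm', Set.inter_eq_left.2 (hTli.extend_subset hst), hTli.span_extend_eq_span hst, span_eq]
    · -- an older stage `m ≥ b - j`: no new vector lies in `N m`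
      have hm2 : b - j ≤ m := by rw [hcast] at hm'; linarith
      have heq : hTli.extend hst ∩ (N m : Set V) = T ∩ (N m : Set V) := by
        refine Set.Subset.antisymm ?_ (Set.inter_subset_inter_left _ (hTli.subset_extend hst))
        rintro v ⟨hvT', hvN⟩
        refine ⟨?_, hvN⟩
        have hvspan : v ∈ span K T := by
          have hv : v ∈ N (b - j) := hN hm2 hvN
          rw [← hTspan (b - j) le_rfl] at hv
          exact span_mono Set.inter_subset_left hv
        exact (hTli.mem_span_iff_id).1 hvspan
          ((hTli.linearIndepOn_extend hst).mono (Set.insert_subset hvT' (hTli.subset_extend hst)))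
      rw [heq]
      exact hTspan m hm2

/-- **Adapted bases exist.** Let `N : ℤ → Submodule K V` be a decreasing filtration of a
finite-dimensional vector space with `N a = ⊤` and `N b = ⊥`. Then there are a basis
`e : Fin n → V` and weights `w : Fin n → ℤ` with `a ≤ w k < b`, `e k ∈ N (w k)`, and, for every
`m : ℤ` and `v : V`: **`v ∈ N m ↔ ∀ k, e.repr v k ≠ 0 → m ≤ w k`** (so `N m = span {e k | m ≤ w k}` and the
classes of the `e k` with `w k = m` form a basis of `N m / N (m + 1)`): Wach's « base de `D` adaptée à la
filtration … `Fil^n D = ⊕_{r_i ≥ n} K u_i` », `r_i` the largest integer with `u_i ∈ Fil^{r_i} D`.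
[cite: Wach1996, §B.2.3, proof of Prop. 2 (p. 394)] -/
theorem exists_basis_mem_iff_of_antitone [Module.Finite K V] (N : ℤ → Submodule K V) (hN : Antitone N)
    {a b : ℤ} (ha : N a = ⊤) (hb : N b = ⊥) :
    ∃ (n : ℕ) (e : Module.Basis (Fin n) K V) (w : Fin n → ℤ),
      (∀ k, a ≤ w k ∧ w k < b) ∧ (∀ k, e k ∈ N (w k)) ∧
      ∀ (m : ℤ) (v : V), v ∈ N m ↔ ∀ k, e.repr v k ≠ 0 → m ≤ w k := by
  classical
  obtain ⟨T, hli, hsub, hspan⟩ := exists_linearIndepOn_span_inter_eq N hN hb (b - a).toNat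
  -- the bottom stage `b - j` lies at or below `a`, so `T` spans `V`
  have hja : b - ((b - a).toNat : ℤ) ≤ a := by
    rcases le_or_gt a b with h | h
    · rw [Int.toNat_of_nonneg (sub_nonneg.2 h)]; linarith
    · rw [Int.toNat_eq_zero.2 (by linarith)]; push_cast; linarith
  have htop : span K T = ⊤ := by
    refine eq_top_iff.2 ?_
    rw [← ha, ← hspan a hja]
    exact span_mono Set.inter_subset_left
  have hli' : LinearIndependent K ((↑) : T → V) := hli
  have hfin : T.Finite := hli'.setFinite
  haveI : Fintype T := hfin.fintype
  -- the basis of `V` carried by `T`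
  let e₀ : Module.Basis T K V := Module.Basis.mk hli' (by rw [Subtype.range_coe, htop])
  have he₀ : ∀ x : T, e₀ x = (x : V) := fun x => by
    simp only [e₀, Module.Basis.coe_mk]
  -- weights: the greatest `m` with `x ∈ N m`
  have hne : ∀ x : T, (x : V) ≠ 0 := fun x => hli.ne_zero x.2
  have hex : ∀ x : T, ∃ ub : ℤ, (x : V) ∈ N ub ∧ ∀ z : ℤ, (x : V) ∈ N z → z ≤ ub := by
    intro x
    refine Int.exists_greatest_of_bdd ⟨b, fun z hz => ?_⟩ ⟨b - (b - a).toNat, hsub x.2⟩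
    by_contra hzb
    have h1 : (x : V) ∈ N b := hN (le_of_not_ge hzb) hz
    rw [hb, mem_bot] at h1
    exact hne x h1
  choose w₀ hw₀ hw₀max using hex
  have key : ∀ (m : ℤ) (x : T), (x : V) ∈ N m ↔ m ≤ w₀ x :=
    fun m x => ⟨fun h => hw₀max x m h, fun h => hN h (hw₀ x)⟩
  -- `N m` is spanned by the vectors of `T` of weight `≥ m`
  have hNm : ∀ m : ℤ, N m = span K (e₀ '' {x : T | m ≤ w₀ x}) := by
    intro m
    have himg : e₀ '' {x : T | m ≤ w₀ x} = T ∩ (N m : Set V) := by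
      ext v
      simp only [Set.mem_image, Set.mem_setOf_eq, he₀, Set.mem_inter_iff, SetLike.mem_coe]
      constructor
      · rintro ⟨x, hx, rfl⟩
        exact ⟨x.2, (key m x).2 hx⟩
      · rintro ⟨hvT, hvN⟩
        exact ⟨⟨v, hvT⟩, (key m ⟨v, hvT⟩).1 hvN, rfl⟩
    rw [himg]
    rcases le_or_gt (b - (b - a).toNat) m with hm | hm
    · exact (hspan m hm).symm
    · -- below the bottom stage everything is `⊤`
      have h1 : N m = ⊤ := eq_top_iff.2 (by
        rw [← htop, span_le]
        exact hsub.trans (hN hm.le))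
      have h2 : T ∩ (N m : Set V) = T := Set.inter_eq_left.2 (by rw [h1]; exact Set.subset_univ _)
      rw [h2, htop, h1]
  -- reindex by `Fin n`
  set σ : T ≃ Fin (Fintype.card T) := Fintype.equivFin T
  refine ⟨Fintype.card T, e₀.reindex σ, fun k => w₀ (σ.symm k), fun k => ⟨?_, ?_⟩, fun k => ?_,
    fun m v => ?_⟩
  · -- `a ≤ w k`: every vector lies in `N a = ⊤`
    exact (key a _).1 (by rw [ha]; exact mem_top)
  · -- `w k < b`: no nonzero vector lies in `N b = ⊥`
    by_contra h
    have h1 : ((σ.symm k : T) : V) ∈ N b := (key b _).2 (le_of_not_gt h)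
    rw [hb, mem_bot] at h1
    exact hne _ h1
  · rw [Module.Basis.reindex_apply, he₀]
    exact hw₀ _
  · rw [hNm m, Module.Basis.mem_span_image]
    constructor
    · intro h k hk
      have hk' : σ.symm k ∈ ((e₀.repr v).support : Set T) := by
        rw [Finset.mem_coe, Finsupp.mem_support_iff, ← Module.Basis.repr_reindex_apply]
        exact hk
      exact h hk'
    · intro h x hx
      rw [Finset.mem_coe, Finsupp.mem_support_iff] at hx
      have h1 := h (σ x) (by rw [Module.Basis.repr_reindex_apply, Equiv.symm_apply_apply]; exact hx)
      simpa only [Equiv.symm_apply_apply, Set.mem_setOf_eq] using h1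

/-- **Consequences of adaptedness** (coordinate form ⇒ the usual form). If
`v ∈ N m ↔ ∀ k, e.repr v k ≠ 0 → m ≤ w k` for all `m, v`, then `e k ∈ N (w k)`, `e k ∉ N (w k + 1)`, and a
linear combination supported on basis vectors of one weight `i` that lies in `N (i + 1)` is trivial
(the classes of the `e k`, `w k = i`, are linearly independent in `N i / N (i + 1)`).
[cite: Wach1996, §B.2.3, proof of Prop. 2 (p. 394)] -/
theorem eq_zero_of_sum_smul_mem_of_forall_mem_iff {ι : Type*} [Fintype ι] (N : ℤ → Submodule K V)
    (e : Module.Basis ι K V) (w : ι → ℤ)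
    (he : ∀ (m : ℤ) (v : V), v ∈ N m ↔ ∀ k, e.repr v k ≠ 0 → m ≤ w k)
    (i : ℤ) (c : ι → K) (hc : ∀ k, c k ≠ 0 → w k = i)
    (hmem : ∑ k, c k • e k ∈ N (i + 1)) : ∀ k, c k = 0 := by
  classical
  intro k
  by_contra hk
  have h1 := (he (i + 1) _).1 hmem k (by rw [e.repr_sum_self]; exact hk)
  rw [hc k hk] at h1
  linarith

/-- The basis vectors of an adapted basis lie in the stages named by their weights, and in no deeper
stage (`r_i` is the LARGEST integer with `u_i ∈ Fil^{r_i} D`). [cite: Wach1996, §B.2.3, proof of Prop. 2 (p. 394)] -/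
theorem mem_and_not_mem_of_forall_mem_iff {ι : Type*} (N : ℤ → Submodule K V)
    (e : Module.Basis ι K V) (w : ι → ℤ)
    (he : ∀ (m : ℤ) (v : V), v ∈ N m ↔ ∀ k, e.repr v k ≠ 0 → m ≤ w k) (k : ι) :
    e k ∈ N (w k) ∧ e k ∉ N (w k + 1) := by
  classical
  constructor
  · refine (he (w k) (e k)).2 fun k' hk' => ?_
    rw [e.repr_self, Finsupp.single_apply] at hk'
    split_ifs at hk' with h
    · rw [h]
    · exact absurd rfl hk'
  · intro h
    have h1 := (he (w k + 1) (e k)).1 h k (by rw [e.repr_self, Finsupp.single_eq_same]; exact one_ne_zero)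
    linarith

end Literature.Algebra.Module
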